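import Summits.Langlands.Langlands.Theorems.IrreducibilityBySelfDualityReciprocityUpToIrreducibilityUnramifiedMatching
import Summits.Langlands.Langlands.Theorems.IrreducibilityBySelfDualityReciprocityUpToIrreducibilityRankTwoConverseAway
import Summits.Langlands.Langlands.Theorems.IrreducibilityBySelfDualityReciprocityUpToIrreducibilityWeilDeligneBridge
import HarnessLib

/-!
# Line `Sketch` for the crux `ReciprocityUpToIrreducibility` (item stmt-Langlands-14328), continuation c5:
# the summit's local–global clause at the unramified places away from `ℓ` IS Satake–Frobenius
# compatibility (every `Rec`; `GL₂` unconditionally, `GL_n` modulo the unramified computation)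

Support file (closes nothing; continuation lead c5, prover-line-stmt-Langlands-14328-c5-0; assembly of
wave 3: registered stubs C2 `stub_rankTwo_satake_of_localGlobal_away` p128294 and Cn
`stub_isUnramifiedAt_and_hasFrobCharpolyAt_of_weilDeligne` p128418, with wave 1 (H4 p127491) and the
N4 assembly `…UnramifiedMatching.lean`).

* `rankTwo_localGlobalCompatibleAt_iff_satakeFrobCompatibleAt_away` — for cuspidal `π` on `GL₂(𝔸_K)`
  unramified at `v ∤ ℓ`, every `ρ : Γ_K → GL₂(ℚ̄_ℓ)` and EVERY reciprocity datum `Rec`: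
  `LocalGlobalCompatibleAt Rec ι π ρ v ↔ SatakeFrobCompatibleAt ι π ρ v` (no hypothesis at all: the
  `v ∤ ℓ` clause needs no Fontaine datum);
* `satakeFrobCompatibleAt_of_localGlobalCompatibleAt_away_of_unramifiedComputation`,
  `localGlobalCompatibleAt_iff_satakeFrobCompatibleAt_away_of_unramifiedComputation` — the same for
  `GL_n`, `2 ≤ n`, modulo the Jacquet–Shalika unramified computation at `(n, 1)` for the irreducible
  smooth representations of `GL_n(K_v)` (hypothesis `hJS`, the named fact
  `hasRSLFactor_of_isSatakeParameter_haar`).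

So on the sector "`π_v` unramified, `v ∤ ℓ`" the summit's rendering of Taylor's Conj. 7 carries exactly
the information of Buzzard–Gee's unramified clause, for every choice of local Langlands data.  (At
`v ∣ ℓ` the clause says "crystalline with the Satake Frobenius", not "unramified": no such converse.)
No definitions; std axioms.

References: H. Carayol, Ann. Sci. ÉNS 19 (1986), Thm. (A) [CarayolASENS1986]; J. Tate, Corvallis
1979, (4.1.6)–(4.2.1) [TateCorvallis1979]; K. Buzzard, T. Gee (2014), Conj. 3.2.1–3.2.2
[BuzzardGeeLMS2014]; M. Harris, R. Taylor (2001), Thm. A [HarrisTaylorAMS2001]; H. Jacquet,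
J. Shalika, Amer. J. Math. 103 (1981), §2 [JacquetShalika1981].
-/

noncomputable section

set_option linter.dupNamespace false -- project-wide option (lakefile weak.linter.dupNamespace); `Summit.Langlands.Langlands` is the mandated namespace

open scoped MatrixGroups Matrix NumberField Classical Polynomial
open Filter IsDedekindDomain Field Polynomial
open Literature.NumberTheory.Automorphic Literature.NumberTheory.GaloisRepresentations
open Literature.NumberTheory.PAdicHodge
open Summit.Langlands

namespace Summit.Langlands.Langlands.Theorems.ReciprocityUpToIrreducibility

variable {K : Type} [Field K] [NumberField K] {ℓ : ℕ} [Fact ℓ.Prime]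

/-! ### `GL₂`: the clause at `v ∤ ℓ`, `π_v` unramified, is an equivalence -/

/-- **`GL₂`, `v ∤ ℓ`: Satake-compatible ⇒ locally–globally compatible, with no Fontaine datum**
(the `v ∤ ℓ` half of `rankTwo_localGlobalCompatibleAt_of_satakeFrobCompatibleAt`: matching data from
`rankTwo_matching_of_satakeFrobCompatibleAt`, clause by c4's `localGlobalCompatibleAt_away_of_isUnramifiedAt`
and the inertia character). [cite: BuzzardGeeLMS2014, Conj. 3.2.1–3.2.2] [cite: TateCorvallis1979, (4.2.1)] -/
theorem rankTwo_localGlobalCompatibleAt_of_satakeFrobCompatibleAt_away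
    {hcpt : isCompact_glFiniteIntegralLevel 2 K} (Rec : ReciprocityData K) (ι : PadicAlgCl ℓ ≃+* ℂ)
    (π : CuspidalAutomorphicRepData 2 K hcpt) (ρ : FramedGaloisRep K (PadicAlgCl ℓ) 2)
    {v : HeightOneSpectrum (𝓞 K)} (hv : ((ℓ : ℕ) : 𝓞 K) ∉ v.asIdeal)
    (hsat : SatakeFrobCompatibleAt ι π.1 ρ v) : LocalGlobalCompatibleAt Rec ι π.1 ρ v := by
  obtain ⟨hρ, πv, rℂ, hloc, htr, hcls⟩ := rankTwo_matching_of_satakeFrobCompatibleAt Rec ι π ρ hsat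
  exact localGlobalCompatibleAt_away_of_isUnramifiedAt Rec ι π.1 ρ hv hρ
    (WeilGroup.exists_inertiaCharacter_ne_one_top (F := v.adicCompletion K) (PadicAlgCl ℓ))
    πv hloc rℂ htr hcls

/-- **`GL₂`, every `Rec`: at a place `v ∤ ℓ` where `π` is unramified, the summit's local–global clause IS
Satake–Frobenius compatibility** — `LocalGlobalCompatibleAt Rec ι π ρ v ↔ SatakeFrobCompatibleAt ι π ρ v`
for every cuspidal `π` on `GL₂(𝔸_K)` unramified at `v`, every `ρ : Γ_K → GL₂(ℚ̄_ℓ)` and EVERY reciprocity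
datum.  `←`: wave N4 (`rankTwo_localGlobalCompatibleAt_of_satakeFrobCompatibleAt_away`); `→`: wave 3,
registered stub C2 (`rankTwo_satakeFrobCompatibleAt_of_localGlobalCompatibleAt_away`: the Carayol local
deduction and the rank-2 Weil–Deligne bridge).  Unconditional.
[cite: CarayolASENS1986, Thm. (A)] [cite: BuzzardGeeLMS2014, Conj. 3.2.1–3.2.2] [cite: TateCorvallis1979, (4.1.6)–(4.2.1)] -/
theorem rankTwo_localGlobalCompatibleAt_iff_satakeFrobCompatibleAt_away
    {hcpt : isCompact_glFiniteIntegralLevel 2 K} (Rec : ReciprocityData K) (ι : PadicAlgCl ℓ ≃+* ℂ)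
    (π : CuspidalAutomorphicRepData 2 K hcpt) (ρ : FramedGaloisRep K (PadicAlgCl ℓ) 2)
    {v : HeightOneSpectrum (𝓞 K)} (hv : ((ℓ : ℕ) : 𝓞 K) ∉ v.asIdeal) (hπ : π.1.IsUnramifiedAt v) :
    LocalGlobalCompatibleAt Rec ι π.1 ρ v ↔ SatakeFrobCompatibleAt ι π.1 ρ v :=
  ⟨rankTwo_satakeFrobCompatibleAt_of_localGlobalCompatibleAt_away Rec ι π ρ v hv hπ,
    rankTwo_localGlobalCompatibleAt_of_satakeFrobCompatibleAt_away Rec ι π ρ hv⟩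

/-- **Registered stub `stub_rankTwo_localGlobalCompatibleAt_iff_away` of line `Sketch` (crux
stmt-Langlands-14328), closed form of `rankTwo_localGlobalCompatibleAt_iff_satakeFrobCompatibleAt_away`.**
[cite: CarayolASENS1986, Thm. (A)] [cite: BuzzardGeeLMS2014, Conj. 3.2.1–3.2.2] -/
theorem stub_rankTwo_localGlobalCompatibleAt_iff_away :
    ∀ (K : Type) [Field K] [NumberField K] (ℓ : ℕ) [Fact ℓ.Prime] (hcpt : isCompact_glFiniteIntegralLevel 2 K)
      (Rec : ReciprocityData K) (ι : PadicAlgCl ℓ ≃+* ℂ) (π : CuspidalAutomorphicRepData 2 K hcpt)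
      (ρ : FramedGaloisRep K (PadicAlgCl ℓ) 2) (v : HeightOneSpectrum (𝓞 K)),
      ((ℓ : ℕ) : 𝓞 K) ∉ v.asIdeal → π.1.IsUnramifiedAt v →
      (LocalGlobalCompatibleAt Rec ι π.1 ρ v ↔ SatakeFrobCompatibleAt ι π.1 ρ v) :=
  fun _ _ _ _ _ _ Rec ι π ρ _ hv hπ =>
    rankTwo_localGlobalCompatibleAt_iff_satakeFrobCompatibleAt_away Rec ι π ρ hv hπ

/-! ### `GL_n`: the same modulo the Jacquet–Shalika unramified computation -/

section RankN

variable {n : ℕ}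

/-- **`GL_n`, `v ∤ ℓ`: local–global compatibility at an unramified place of `π` forces Satake–Frobenius
compatibility, for every `Rec`, modulo the unramified computation** (hypothesis `hJS`: the named fact
`hasRSLFactor_of_isSatakeParameter_haar` at `(n, 1)` for the irreducible smooth representations of
`GL_n(K_v)`).  Unpack the clause; the Frobenius-semisimplification `rℂ^{F-ss} = r'` lies in
`rec_v(π_v)`, so by stub H4 (`stub_recGL_unramified_of_unramifiedComputation`, clause (iii-L) + `hJS`)
`r'` has `N = 0`, trivial inertia and geometric-Frobenius characteristic polynomial `∏ (X - a)` for the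
Satake parameter `α` of `π` at `v`; these pass to `rℂ` (same `N`, same inertia action, Frobenius
differing by a commuting nilpotent); the rank-`n` Weil–Deligne bridge (stub Cn,
`isUnramifiedAt_and_hasFrobCharpolyAt_of_weilDeligne_wdBridge`) returns `ρ` unramified at `v` with the
Satake Frobenius polynomial. [cite: JacquetShalika1981, §2] [cite: HarrisTaylorAMS2001, Thm. A (ii), (v)]
[cite: TateCorvallis1979, (4.1.6)–(4.2.1)] -/
theorem satakeFrobCompatibleAt_of_localGlobalCompatibleAt_away_of_unramifiedComputation (hn : 1 < n)
    {hcpt : isCompact_glFiniteIntegralLevel n K} (Rec : ReciprocityData K) (ι : PadicAlgCl ℓ ≃+* ℂ)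
    (π : CuspidalAutomorphicRepData n K hcpt) (ρ : FramedGaloisRep K (PadicAlgCl ℓ) n)
    {v : HeightOneSpectrum (𝓞 K)} (hv : ((ℓ : ℕ) : 𝓞 K) ∉ v.asIdeal)
    (hJS : ∀ (πv : SmoothIrrep (GL (Fin n) (v.adicCompletion K)))
      (ψ : AddChar (v.adicCompletion K) Circle)
      [MeasurableSpace (GL (Fin 1) (v.adicCompletion K) ⧸ upperUnitriangular (Fin 1) (v.adicCompletion K))]
      [BorelSpace (GL (Fin 1) (v.adicCompletion K) ⧸ upperUnitriangular (Fin 1) (v.adicCompletion K))]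
      (ν : MeasureTheory.Measure
        (GL (Fin 1) (v.adicCompletion K) ⧸ upperUnitriangular (Fin 1) (v.adicCompletion K)))
      [MeasureTheory.SMulInvariantMeasure (GL (Fin 1) (v.adicCompletion K))
        (GL (Fin 1) (v.adicCompletion K) ⧸ upperUnitriangular (Fin 1) (v.adicCompletion K)) ν]
      [MeasureTheory.IsFiniteMeasureOnCompacts ν] [ν.IsOpenPosMeasure],
      hasRSLFactor_of_isSatakeParameter_haar hn πv.ρ
        (Representation.trivial ℂ (GL (Fin 1) (v.adicCompletion K)) ℂ) ψ ν)
    (hπ : π.1.IsUnramifiedAt v) (hLG : LocalGlobalCompatibleAt Rec ι π.1 ρ v) :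
    SatakeFrobCompatibleAt ι π.1 ρ v := by
  obtain ⟨α, hα⟩ := hπ
  obtain ⟨πv, rv, rℂ, hloc, hWD, -, hT, r', hr', hc⟩ := hLG
  -- automorphic side: the representative `r' = rℂ^{F-ss}` of `rec_v(π_v)`
  obtain ⟨hN', hρ', hchar'⟩ :=
    stub_recGL_unramified_of_unramifiedComputation K n hn hcpt π v α hα (Rec.llc v) πv hloc
      (by intro ψ _ _ ν _ _ _; exact hJS πv ψ ν) r' hr'.isFrobSemisimple hc.symm
  -- … transferred to `rℂ`
  have hN : rℂ.N = 0 := hr'.1.symm.trans hN'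
  have hur : WeilGroup.IsUnramifiedRep rℂ.ρ := fun u hu => (hr'.2.1 u hu).symm.trans (hρ' u hu)
  have hch : ∀ Φ : WeilGroup (v.adicCompletion K), WeilGroup.deg Φ = -1 →
      (rℂ.ρ Φ).charpoly = (α.map fun a => X - C a).prod := fun Φ hΦ => by
    obtain ⟨-, m, hm, hcm, hsum⟩ := hr'.2.2 Φ
    rw [hsum, LinearMap.charpoly_add_eq_of_isNilpotent_of_commute hm hcm, hchar' Φ hΦ]
  -- Galois side: the bridge
  obtain ⟨hunr, hcp⟩ :=
    isUnramifiedAt_and_hasFrobCharpolyAt_of_weilDeligne_wdBridge ι ρ v (hWD hv) hT hN hur hch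
  exact ⟨α, hα, hunr, hcp⟩

/-- **`GL_n`, every `Rec`: at `v ∤ ℓ` with `π_v` unramified, `LocalGlobalCompatibleAt ↔ SatakeFrobCompatibleAt`,
modulo the Jacquet–Shalika unramified computation** (`→`:
`satakeFrobCompatibleAt_of_localGlobalCompatibleAt_away_of_unramifiedComputation`; `←`:
`localGlobalCompatibleAt_of_satakeFrobCompatibleAt_of_unramifiedComputation` of `…UnramifiedMatching.lean`,
whose `FontaineDatumExists` hypothesis is idle at `v ∤ ℓ` but kept in its signature — here it is taken as
an argument). [cite: JacquetShalika1981, §2] [cite: BuzzardGeeLMS2014, Conj. 3.2.1–3.2.2]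
[cite: TateCorvallis1979, (4.1.6)–(4.2.1)] -/
theorem localGlobalCompatibleAt_iff_satakeFrobCompatibleAt_away_of_unramifiedComputation
    (hF : FontaineDatumExists) (hn : 1 < n)
    {hcpt : isCompact_glFiniteIntegralLevel n K} (Rec : ReciprocityData K) (ι : PadicAlgCl ℓ ≃+* ℂ)
    (π : CuspidalAutomorphicRepData n K hcpt) (ρ : FramedGaloisRep K (PadicAlgCl ℓ) n)
    {v : HeightOneSpectrum (𝓞 K)} (hv : ((ℓ : ℕ) : 𝓞 K) ∉ v.asIdeal)
    (hJS : ∀ (πv : SmoothIrrep (GL (Fin n) (v.adicCompletion K)))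
      (ψ : AddChar (v.adicCompletion K) Circle)
      [MeasurableSpace (GL (Fin 1) (v.adicCompletion K) ⧸ upperUnitriangular (Fin 1) (v.adicCompletion K))]
      [BorelSpace (GL (Fin 1) (v.adicCompletion K) ⧸ upperUnitriangular (Fin 1) (v.adicCompletion K))]
      (ν : MeasureTheory.Measure
        (GL (Fin 1) (v.adicCompletion K) ⧸ upperUnitriangular (Fin 1) (v.adicCompletion K)))
      [MeasureTheory.SMulInvariantMeasure (GL (Fin 1) (v.adicCompletion K))
        (GL (Fin 1) (v.adicCompletion K) ⧸ upperUnitriangular (Fin 1) (v.adicCompletion K)) ν]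
      [MeasureTheory.IsFiniteMeasureOnCompacts ν] [ν.IsOpenPosMeasure],
      hasRSLFactor_of_isSatakeParameter_haar hn πv.ρ
        (Representation.trivial ℂ (GL (Fin 1) (v.adicCompletion K)) ℂ) ψ ν)
    (hπ : π.1.IsUnramifiedAt v) :
    LocalGlobalCompatibleAt Rec ι π.1 ρ v ↔ SatakeFrobCompatibleAt ι π.1 ρ v :=
  ⟨satakeFrobCompatibleAt_of_localGlobalCompatibleAt_away_of_unramifiedComputation hn Rec ι π ρ hv hJS hπ,
    localGlobalCompatibleAt_of_satakeFrobCompatibleAt_of_unramifiedComputation hF hn Rec ι π ρ hJS⟩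

end RankN

end Summit.Langlands.Langlands.Theorems.ReciprocityUpToIrreducibility

end
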